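import Mathlib
import Summits.Ventures.PercRepro2.HCov
import Summits.Ventures.PercRepro2.HCovSwap
import Summits.Ventures.PercRepro2.PendantRoot

/-!
# The cross term (J1) at a pendant `b` reduces to (J1) at the attachment vertex
(blind cell PercRepro2, mine-a g10 — MINE-A.md §53.9)

If `b` is a leaf attached to `y` by the edge `f` (weight `q = p f`), then `{x ↔ b} = {f open} ∩ {x ↔ y}`
for every `x ≠ b`, and every event not mentioning `b` is independent of `f`.  Hence each `b`-term of the
cleared cross term is `q` times the corresponding `y`-term (`term_pendant`), `σ_b = 1[f open] · σ_y`, and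

  `J1c(b) = q · J1c(y)`   (`J1_pendant_b`),

where `J1c = P(Q) · E_Q[σ_b · D·H] − E_Q[σ_b] · E_Q[D·H]` is the cross term `Cov_μ(σ_b, H)` cleared by
`P(Q)² · D` (`D = P(PD)`, `D_o = P(PD, o ∈ U)`, `D·H = σ₃ (D_o − D · 1[o ∈ U, o ↮ a₃])`).  At `y = a₁` the
cross term vanishes (`J1_root_zero`: `σ_{a₁} = 1_Q`).  Together with `J1Coinc.J1_coinc_o` /
`J1_coinc_a3` (the cases `y = o`, `y = a₃`), (J1) holds at every pendant `b` attached to a marked vertex.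
-/

namespace Summit.Ventures.PercRepro2

open UnionCluster PendantRoot

namespace J1Pendant

section Pendant

variable {V : Type*} {E : Type*} [Fintype E] [DecidableEq E] [Fintype V] [DecidableEq V]
  {R : Type*} [Field R] [LinearOrder R] [IsStrictOrderedRing R]

variable (p : E → R) {ends : E → Sym2 V} {f : E} {b y : V}

omit [Fintype V] [DecidableEq V] [LinearOrder R] [IsStrictOrderedRing R] in
/-- **The leaf term identity**: for `b` a leaf at `y` via `f`, a free event `A` and `x ≠ b`,
`P(A ∩ {x ↔ b}) = p f · P(A ∩ {x ↔ y})`. -/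
lemma term_pendant (hf : ends f = s(b, y)) (hleaf : ∀ e, b ∈ ends e → e = f) (hby : b ≠ y)
    {A : Set (Config E)} (hA : Free f A) {x : V} (hx : b ≠ x) :
    prob p (A ∩ connEvent ends x b) = p f * prob p (A ∩ connEvent ends x y) := by
  rw [connEvent_other_leaf hf hleaf hby hx]
  have e : A ∩ (openEdge f ∩ connEvent ends x y) = (A ∩ connEvent ends x y) ∩ openEdge f := by
    ext ω; simp only [Set.mem_inter_iff]; tauto
  rw [e, prob_inter_openEdge_of_free p
    (hA.inter (free_connEvent hf hleaf hby hx.symm hby.symm)), mul_comm]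

omit [Fintype E] [DecidableEq E] [Fintype V] [DecidableEq V] in
/-- The complement of a connection between non-leaf vertices is free. -/
lemma free_compl_conn (hf : ends f = s(b, y)) (hleaf : ∀ e, b ∈ ends e → e = f) (hby : b ≠ y)
    {u v : V} (hu : b ≠ u) (hv : b ≠ v) : Free f (connEvent ends u v)ᶜ :=
  (free_connEvent hf hleaf hby hu.symm hv.symm).compl

variable (ends) (o a₁ a₂ a₃ : V)

local notation3 "Q" => avoidAll ends a₂ {a₁}
local notation3 "oL" => connEvent ends a₁ o
local notation3 "oH" => connEvent ends a₂ o
local notation3 "tL" => connEvent ends a₁ a₃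
local notation3 "tH" => connEvent ends a₂ a₃
local notation3 "tN" => (connEvent ends a₁ a₃)ᶜ ∩ (connEvent ends a₂ a₃)ᶜ

omit [Fintype V] [DecidableEq V] [LinearOrder R] [IsStrictOrderedRing R] in
/-- **(J1) at a pendant `b` is `p f` times (J1) at the attachment vertex `y`** (cleared form):
with `D = P(Q ∩ tN)`, `D_o = P(Q ∩ tN ∩ oL) + P(Q ∩ tN ∩ oH)`, `EDH = D_o (P(Q∩tL) − P(Q∩tH)) − D (P(Q∩tL∩oH) − P(Q∩tH∩oL))`
and, for a vertex `v`, `EvDH(v) = D_o (P(Q∩tL∩vL) − P(Q∩tL∩vH)) − D (P(Q∩tL∩oH∩vL) − P(Q∩tL∩oH∩vH))`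
`− D_o (P(Q∩tH∩vL) − P(Q∩tH∩vH)) + D (P(Q∩tH∩oL∩vL) − P(Q∩tH∩oL∩vH))`, `Ev(v) = P(Q∩vL) − P(Q∩vH)`:
`P(Q) · EvDH(b) − Ev(b) · EDH = p f · (P(Q) · EvDH(y) − Ev(y) · EDH)`. -/
theorem J1_pendant_b (hf : ends f = s(b, y)) (hleaf : ∀ e, b ∈ ends e → e = f) (hby : b ≠ y)
    (hbo : b ≠ o) (hb1 : b ≠ a₁) (hb2 : b ≠ a₂) (hb3 : b ≠ a₃) :
    prob p Q *
        ((prob p (Q ∩ tN ∩ oL) + prob p (Q ∩ tN ∩ oH)) *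
            (prob p (Q ∩ tL ∩ connEvent ends a₁ b) - prob p (Q ∩ tL ∩ connEvent ends a₂ b)) -
          prob p (Q ∩ tN) *
            (prob p (Q ∩ tL ∩ oH ∩ connEvent ends a₁ b) - prob p (Q ∩ tL ∩ oH ∩ connEvent ends a₂ b)) -
          (prob p (Q ∩ tN ∩ oL) + prob p (Q ∩ tN ∩ oH)) *
            (prob p (Q ∩ tH ∩ connEvent ends a₁ b) - prob p (Q ∩ tH ∩ connEvent ends a₂ b)) +
          prob p (Q ∩ tN) *
            (prob p (Q ∩ tH ∩ oL ∩ connEvent ends a₁ b) - prob p (Q ∩ tH ∩ oL ∩ connEvent ends a₂ b))) -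
      (prob p (Q ∩ connEvent ends a₁ b) - prob p (Q ∩ connEvent ends a₂ b)) *
        ((prob p (Q ∩ tN ∩ oL) + prob p (Q ∩ tN ∩ oH)) * (prob p (Q ∩ tL) - prob p (Q ∩ tH)) -
          prob p (Q ∩ tN) * (prob p (Q ∩ tL ∩ oH) - prob p (Q ∩ tH ∩ oL))) =
    p f *
      (prob p Q *
          ((prob p (Q ∩ tN ∩ oL) + prob p (Q ∩ tN ∩ oH)) *
              (prob p (Q ∩ tL ∩ connEvent ends a₁ y) - prob p (Q ∩ tL ∩ connEvent ends a₂ y)) -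
            prob p (Q ∩ tN) *
              (prob p (Q ∩ tL ∩ oH ∩ connEvent ends a₁ y) - prob p (Q ∩ tL ∩ oH ∩ connEvent ends a₂ y)) -
            (prob p (Q ∩ tN ∩ oL) + prob p (Q ∩ tN ∩ oH)) *
              (prob p (Q ∩ tH ∩ connEvent ends a₁ y) - prob p (Q ∩ tH ∩ connEvent ends a₂ y)) +
            prob p (Q ∩ tN) *
              (prob p (Q ∩ tH ∩ oL ∩ connEvent ends a₁ y) - prob p (Q ∩ tH ∩ oL ∩ connEvent ends a₂ y))) -
        (prob p (Q ∩ connEvent ends a₁ y) - prob p (Q ∩ connEvent ends a₂ y)) *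
          ((prob p (Q ∩ tN ∩ oL) + prob p (Q ∩ tN ∩ oH)) * (prob p (Q ∩ tL) - prob p (Q ∩ tH)) -
            prob p (Q ∩ tN) * (prob p (Q ∩ tL ∩ oH) - prob p (Q ∩ tH ∩ oL)))) := by
  have hQ : Free f Q := by
    rw [avoidAll_eq_compl]
    exact (free_connEvent hf hleaf hby hb1.symm hb2.symm).compl
  have hQtL : Free f (Q ∩ tL) := hQ.inter (free_connEvent hf hleaf hby hb1.symm hb3.symm)
  have hQtH : Free f (Q ∩ tH) := hQ.inter (free_connEvent hf hleaf hby hb2.symm hb3.symm)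
  have hQtLoH : Free f (Q ∩ tL ∩ oH) := hQtL.inter (free_connEvent hf hleaf hby hb2.symm hbo.symm)
  have hQtHoL : Free f (Q ∩ tH ∩ oL) := hQtH.inter (free_connEvent hf hleaf hby hb1.symm hbo.symm)
  rw [term_pendant p hf hleaf hby hQ hb1, term_pendant p hf hleaf hby hQ hb2,
    term_pendant p hf hleaf hby hQtL hb1, term_pendant p hf hleaf hby hQtL hb2,
    term_pendant p hf hleaf hby hQtH hb1, term_pendant p hf hleaf hby hQtH hb2,
    term_pendant p hf hleaf hby hQtLoH hb1, term_pendant p hf hleaf hby hQtLoH hb2,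
    term_pendant p hf hleaf hby hQtHoL hb1, term_pendant p hf hleaf hby hQtHoL hb2]
  ring

omit [Fintype E] [DecidableEq E] [Fintype V] [DecidableEq V] in
/-- `{a₁ ↔ a₁}` is everything. -/
lemma inter_conn_self (X : Set (Config E)) : X ∩ connEvent ends a₁ a₁ = X := by
  ext ω; simp only [Set.mem_inter_iff, mem_connEvent]; exact ⟨fun h => h.1, fun h => ⟨h, conn_refl _ _ _⟩⟩

omit [Fintype E] [DecidableEq E] [Fintype V] [DecidableEq V] in
/-- A subset of `Q` meets `{a₂ ↔ a₁}` in the empty set. -/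
lemma inter_conn_roots_of_subset {A : Set (Config E)} (hA : A ⊆ Q) :
    A ∩ connEvent ends a₂ a₁ = ∅ := by
  ext ω
  simp only [Set.mem_inter_iff, mem_connEvent, Set.mem_empty_iff_false, iff_false, not_and]
  exact fun h hc => (hA h) a₁ (Finset.mem_singleton_self a₁) hc

omit [Fintype V] [DecidableEq V] [LinearOrder R] [IsStrictOrderedRing R] in
/-- **(J1) vanishes at `b = a₁`** (`σ_{a₁} = 1_Q`): the `y = a₁` instance of the right-hand side of
`J1_pendant_b` is `0`, so (J1) holds with equality at every pendant `b` attached to a root. -/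
theorem J1_root_zero :
    prob p Q *
        ((prob p (Q ∩ tN ∩ oL) + prob p (Q ∩ tN ∩ oH)) *
            (prob p (Q ∩ tL ∩ connEvent ends a₁ a₁) - prob p (Q ∩ tL ∩ connEvent ends a₂ a₁)) -
          prob p (Q ∩ tN) *
            (prob p (Q ∩ tL ∩ oH ∩ connEvent ends a₁ a₁) - prob p (Q ∩ tL ∩ oH ∩ connEvent ends a₂ a₁)) -
          (prob p (Q ∩ tN ∩ oL) + prob p (Q ∩ tN ∩ oH)) *
            (prob p (Q ∩ tH ∩ connEvent ends a₁ a₁) - prob p (Q ∩ tH ∩ connEvent ends a₂ a₁)) +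
          prob p (Q ∩ tN) *
            (prob p (Q ∩ tH ∩ oL ∩ connEvent ends a₁ a₁) - prob p (Q ∩ tH ∩ oL ∩ connEvent ends a₂ a₁))) -
      (prob p (Q ∩ connEvent ends a₁ a₁) - prob p (Q ∩ connEvent ends a₂ a₁)) *
        ((prob p (Q ∩ tN ∩ oL) + prob p (Q ∩ tN ∩ oH)) * (prob p (Q ∩ tL) - prob p (Q ∩ tH)) -
          prob p (Q ∩ tN) * (prob p (Q ∩ tL ∩ oH) - prob p (Q ∩ tH ∩ oL))) = 0 := by
  rw [inter_conn_self, inter_conn_self, inter_conn_self, inter_conn_self, inter_conn_self,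
    inter_conn_roots_of_subset ends a₁ a₂ (A := Q ∩ tL) Set.inter_subset_left,
    inter_conn_roots_of_subset ends a₁ a₂ (A := Q ∩ tL ∩ oH)
      (Set.inter_subset_left.trans Set.inter_subset_left),
    inter_conn_roots_of_subset ends a₁ a₂ (A := Q ∩ tH) Set.inter_subset_left,
    inter_conn_roots_of_subset ends a₁ a₂ (A := Q ∩ tH ∩ oL)
      (Set.inter_subset_left.trans Set.inter_subset_left),
    inter_conn_roots_of_subset ends a₁ a₂ (A := Q) subset_rfl, prob_empty]
  ring

end Pendant

end J1Pendant

end Summit.Ventures.PercRepro2
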